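import Literature.Computability.AlgebraicComplexity.IMMStarWalks
import HarnessLib

/-!
# The monomials of `∂_α ρ_{J,V} IMM^*` as unions of block entries (Kumar–Saraf 2017, §8.1, §8.5)

Topic `Literature/Computability/AlgebraicComplexity`; infrastructure for the printed proof of
`kumarSaraf2017_imm_homDepthFour` (`HomogeneousDepthFour.lean`), Step 5 of the roadmap
(bookkeeping). For a good walk `v` of the block layout (`IMMStarLayout.lean`, `IMMStarWalks.lean`)
the monomial `x^{walk v ∖ Jset - 1_α}` of `∂_α ρ_{J,V} IMM` consists exactly of the entries read in
the regular layers, block by block: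

* `embed b` — the entry `(j, u, c)` of block `b` as a variable `(posX b j, u, c)` of `IMM`;
  `xSupport v = ⋃_b embed b '' entries (toBlocks v b)`;
* **`support_walkMonomial_eq`** — `supp (walk v ∖ Jset - 1_α) = xSupport v` for good `v`;
* **`card_xSupport_union_add`** — for good `v, w`:
  `|xSupport v ∪ xSupport w| + ∑_b |agree (toBlocks v b) (toBlocks w b)| = 2 r k`
  (so the distance `Δ` of the two monomials, [KS, Def. 3.4], is `r k - ∑_b |agree_b|`), and
  `card_xSupport` (`= r k`: the `k` of [KS], "`n - 2r'`" regular variables per monomial).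

Everything is proved; no named facts.

## References

* M. Kumar, S. Saraf, *On the power of homogeneous depth 4 arithmetic circuits*, SIAM J. Comput.
  46 (2017) 336–387 (arXiv:1404.1950): §8.1, §8.5, Def. 3.4.
-/

noncomputable section

namespace Literature.Computability.AlgebraicComplexity.KumarSaraf

open Finset IMMWalk

variable {r k e N : ℕ} (hN : 0 < N)

/-- The entry `(j, u, c)` of the regular part of block `b`, as a variable of `IMM`.
[cite: KumarSaraf2017, §8.1] -/
def embed (b : Fin r) (x : Fin k × Fin N × Fin N) : Fin (nL r k e) × Fin N × Fin N :=
  (posX b x.1.castSucc, x.2.1, x.2.2)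

/-- `embed` is injective in the entry. [folklore] -/
theorem embed_injective (b : Fin r) : Function.Injective (embed (k := k) (e := e) (N := N) b) := by
  intro x y h
  unfold embed at h
  rw [Prod.mk.injEq, Prod.mk.injEq] at h
  obtain ⟨h1, h2, h3⟩ := h
  exact Prod.ext (posX_castSucc_inj h1).2 (Prod.ext h2 h3)

/-- `embed` separates the blocks. [folklore] -/
theorem embed_ne_of_ne {b b' : Fin r} (hbb : b ≠ b') (x y : Fin k × Fin N × Fin N) :
    embed (e := e) b x ≠ embed b' y := by
  intro h
  unfold embed at h
  rw [Prod.mk.injEq] at h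
  exact hbb (posX_castSucc_inj h.1).1

/-- The regular entries of a closed walk, block by block, as variables of `IMM`.
[cite: KumarSaraf2017, §8.1] -/
def xSupport (v : Fin (nL r k e) → Fin N) : Finset (Fin (nL r k e) × Fin N × Fin N) :=
  univ.biUnion fun b : Fin r => (entries (toBlocks (e := e) v b)).image (embed b)

/-- The support of a multilinear vector minus the indicator of a duplicate-free list inside it.
[folklore] -/
theorem support_sub_listInd {σ : Type*} [DecidableEq σ] {f : σ →₀ ℕ} (hf : ∀ x, f x ≤ 1)
    {L : List σ} (hL : L.Nodup) : (f - GKKS.listInd L).support = f.support \ L.toFinset := by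
  ext x
  rw [Finsupp.mem_support_iff, Finsupp.tsub_apply, mem_sdiff, Finsupp.mem_support_iff,
    List.mem_toFinset]
  have h1 := hf x
  by_cases hx : x ∈ L
  · rw [GKKS.listInd_apply_of_mem hL hx]
    constructor
    · intro h; omega
    · intro h; exact absurd hx h.2
  · rw [GKKS.listInd_apply_of_not_mem hx]
    simp [hx]

/-- **The monomial of a good walk consists of its regular entries**: for a good walk `v`,
`supp (walk v ∖ Jset - 1_α) = xSupport v`. [cite: KumarSaraf2017, §8.5] -/
theorem support_walkMonomial_eq (hr : 0 < r) (ξ : Fin r → Fin k × Fin N → Finset (Fin N))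
    (α : Fin r → Fin N) {v : Fin (nL r k e) → Fin N} (hv : GoodWalk (e := e) hN ξ α v) :
    (eraseVars (Jset (N := N)) (closedWalkExp v) - GKKS.listInd (Lalpha (k := k) (e := e) hN α)).support
      = xSupport (e := e) v := by
  classical
  obtain ⟨hG1, hG2, hG3⟩ := hv
  rw [support_sub_listInd (eraseVars_closedWalkExp_le_one _ v) (nodup_Lalpha hN α),
    support_eraseVars]
  ext x
  rw [mem_sdiff, mem_sdiff, mem_support_closedWalkExp_iff, List.mem_toFinset, xSupport, mem_biUnion]
  constructor
  · rintro ⟨⟨hxeq, hxJ⟩, hxL⟩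
    set t := x.1 with ht
    rw [hxeq] at hxJ hxL ⊢
    by_cases hlt : (t : ℕ) < r * (k + 2)
    · obtain ⟨hb, heq, hi⟩ := div_mod_of_lt hlt
      set b : Fin r := ⟨(t : ℕ) / (k + 2), hb⟩ with hbdef
      by_cases hi0 : (t : ℕ) % (k + 2) = 0
      · -- `Y` layer: the variable is in `α`
        exfalso; apply hxL
        have htY : t = posY b := Fin.ext (by simp only [posY_val, hbdef]; omega)
        rw [Lalpha, List.mem_ofFn]
        refine ⟨b, ?_⟩
        rw [htY, finRotate_posY hr, (hG1 b).1, (hG1 b).2]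
      · by_cases hik : (t : ℕ) % (k + 2) ≤ k
        · -- `X` layer
          have hj : (t : ℕ) % (k + 2) - 1 < k := by omega
          set j : Fin k := ⟨_, hj⟩ with hjdef
          have htX : t = posX b j.castSucc :=
            Fin.ext (by simp only [posX_val, Fin.val_castSucc, hbdef, hjdef]; omega)
          refine ⟨b, mem_univ _, mem_image.2 ⟨entryAt (toBlocks (e := e) v b) j, mem_entries.2 rfl, ?_⟩⟩
          rw [htX, finRotate_posX_castSucc hr]
          rfl
        · -- `J` layer: in `Jset`
          exfalso; apply hxJ
          rw [Jset, mem_filter]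
          refine ⟨mem_univ _, Or.inl ⟨b, Fin.ext ?_⟩⟩
          dsimp only
          simp only [posX_val, Fin.val_last, hbdef]; omega
    · -- identity layer: in `Jset`
      exfalso; apply hxJ
      rw [Jset, mem_filter]
      refine ⟨mem_univ _, Or.inr ⟨not_lt.1 hlt, ?_⟩⟩
      dsimp only
      rw [hG3 t (not_lt.1 hlt)]
      by_cases hnext : (t : ℕ) + 1 < nL r k e
      · refine (hG3 _ ?_).symm
        rw [val_finRotate_nL hr, if_pos hnext]; omega
      · have : finRotate (nL r k e) t = posY ⟨0, hr⟩ := by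
          apply Fin.ext; rw [val_finRotate_nL hr, if_neg hnext, posY_val]; simp
        rw [this, (hG1 _).1]
  · rintro ⟨b, -, hx⟩
    rw [mem_image] at hx
    obtain ⟨y, hy, rfl⟩ := hx
    rw [mem_entries] at hy
    rw [← hy]
    refine ⟨⟨?_, ?_⟩, ?_⟩
    · -- the embedded entry is the variable of layer `posX b y.1`
      simp only [embed, entryAt, toBlocks, finRotate_posX_castSucc hr]
    · rw [Jset, mem_filter, not_and_or]
      right; push Not
      exact ⟨fun b' => posX_castSucc_ne_posJ b b' _, fun h => absurd h (not_le.2 (posX_val_lt b _))⟩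
    · rw [Lalpha, List.mem_ofFn]
      rintro ⟨b', hb'⟩
      have := congrArg Prod.fst hb'
      exact posX_castSucc_ne_posY b b' _ this.symm

/-- The regular entries of two closed walks together, block by block. [folklore] -/
theorem xSupport_union (v w : Fin (nL r k e) → Fin N) :
    xSupport (e := e) v ∪ xSupport w =
      univ.biUnion fun b : Fin r => (entries (toBlocks (e := e) v b) ∪ entries (toBlocks w b)).image (embed b) := by
  classical
  ext x
  simp only [xSupport, mem_union, mem_biUnion, mem_univ, true_and, mem_image]
  constructor
  · rintro (⟨b, y, hy, rfl⟩ | ⟨b, y, hy, rfl⟩)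
    · exact ⟨b, y, Or.inl hy, rfl⟩
    · exact ⟨b, y, Or.inr hy, rfl⟩
  · rintro ⟨b, y, hy | hy, rfl⟩
    · exact Or.inl ⟨b, y, hy, rfl⟩
    · exact Or.inr ⟨b, y, hy, rfl⟩

/-- **The size of the union of two walk monomials, block by block**:
`|xSupport v ∪ xSupport w| + ∑_b |agree_b| = 2 r k` (the two monomials are at distance
`Δ = r k - ∑_b |agree (toBlocks v b) (toBlocks w b)|`, [KS, Def. 3.4]). [cite: KumarSaraf2017, Def. 3.4] -/
theorem card_xSupport_union_add (v w : Fin (nL r k e) → Fin N) :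
    (xSupport (e := e) v ∪ xSupport w).card +
        ∑ b : Fin r, (agree (toBlocks (e := e) v b) (toBlocks w b)).card = 2 * (r * k) := by
  classical
  rw [xSupport_union, card_biUnion]
  · have h : ∀ b : Fin r, ((entries (toBlocks (e := e) v b) ∪ entries (toBlocks w b)).image
        (embed (e := e) b)).card + (agree (toBlocks (e := e) v b) (toBlocks w b)).card = 2 * k := by
      intro b
      rw [card_image_of_injective _ (embed_injective b), card_entries_union]
    rw [← sum_add_distrib, sum_congr rfl fun b _ => h b, sum_const, card_univ, Fintype.card_fin,
      smul_eq_mul]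
    ring
  · intro b _ b' _ hbb
    rw [Function.onFun, disjoint_left]
    intro x hx hx'
    rw [mem_image] at hx hx'
    obtain ⟨y, -, rfl⟩ := hx
    obtain ⟨y', -, h⟩ := hx'
    exact embed_ne_of_ne (Ne.symm hbb) y' y h

/-- The size of one walk monomial: `r k` regular entries. [cite: KumarSaraf2017, §8.5] -/
theorem card_xSupport (v : Fin (nL r k e) → Fin N) : (xSupport (e := e) v).card = r * k := by
  have h := card_xSupport_union_add (e := e) v v
  rw [union_self] at h
  have hagree : ∀ b : Fin r, (agree (toBlocks (e := e) v b) (toBlocks v b)).card = k := by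
    intro b
    rw [agree, filter_true_of_mem (fun _ _ => rfl), card_univ, Fintype.card_fin]
  rw [sum_congr rfl fun b _ => hagree b, sum_const, card_univ, Fintype.card_fin, smul_eq_mul] at h
  omega

end Literature.Computability.AlgebraicComplexity.KumarSaraf

end
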